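import Summits.QuantumFields.YangMills.Theorems.IR.EsPolymerESRung
import Summits.QuantumFields.YangMills.Theorems.IR.EsPolymerDefsK

/-!
# Crux `IR` (item stmt-QuantumFields-19354) — line «es-polymer-decoupling»: the reshaped format refines the original
(`DPRk ⇒ DPR`, `ESRungK ⇒ ESRung`)

Helper module for item `stmt-QuantumFields-19354` (`--supports … --as helper`; lead prover ym-ir-line-mxc-p1 g2).  Under
`Compatible Γ` the radius-`1` near family of a cell is empty or the singleton of the owner (`nearFamily_one_cases`), so the
owner hypothesis of `DPR`'s clause (I) gives disjoint near families (`disjoint_nearFamily_one_of_owner`) and a near-family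
functional is an owner functional: `dpr_of_dprk`, `esRung_of_esRungK`.  Bookkeeping only; HONEST FRAMING as in
`Theorems/IR/EsPolymerDefsK.lean` (nothing about the weak-coupling load or the YM mass gap is proved here). -/

set_option autoImplicit false

noncomputable section

open MeasureTheory Finset
open Literature.MathematicalPhysics.QuantumFieldTheory

namespace Summit.QuantumFields.YangMills.Cruxes.IR.EsPolymer

/-- Under compatibility every polymer of the radius-`1` near family of `c` IS the owner of `c`. -/
theorem eq_owner_of_mem_nearFamily_one {q : ℕ} {Γ : Finset (Finset (Cell q))} (hΓ : Compatible Γ) {c : Cell q}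
    {γ : Finset (Cell q)} (hγ : γ ∈ nearFamily Γ c 1) : γ = owner Γ c := by
  classical
  obtain ⟨hγΓ, c', hc', hd⟩ := mem_nearFamily.1 hγ
  have hmem : γ ∈ Γ.filter fun γ' => ∃ c'' ∈ γ', cellDist c c'' ≤ 2 := mem_filter.2 ⟨hγΓ, c', hc', by omega⟩
  have hsub : γ ⊆ owner Γ c := Finset.le_sup (f := id) hmem
  obtain ⟨ho, -⟩ := owner_mem_of_ne_empty hΓ (ne_empty_of_mem (hsub hc'))
  by_contra hne
  have h7 := hΓ.2 γ hγΓ (owner Γ c) ho hne c' hc' c' (hsub hc')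
  have := cellDist_self c'
  omega

/-- Under compatibility the radius-`1` near family is empty (cell unowned) or the singleton of the (nonempty) owner. -/
theorem nearFamily_one_cases {q : ℕ} {Γ : Finset (Finset (Cell q))} (hΓ : Compatible Γ) (c : Cell q) :
    (nearFamily Γ c 1 = ∅ ∧ owner Γ c = ∅) ∨ (nearFamily Γ c 1 = {owner Γ c} ∧ owner Γ c ≠ ∅) := by
  classical
  rcases (nearFamily Γ c 1).eq_empty_or_nonempty with h | ⟨γ, hγ⟩
  · refine Or.inl ⟨h, ?_⟩
    rw [owner_eq_sup_nearFamily, h, sup_empty, bot_eq_empty]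
  · have hγo := eq_owner_of_mem_nearFamily_one hΓ hγ
    refine Or.inr ⟨?_, ?_⟩
    · ext γ'
      simp only [mem_singleton]
      exact ⟨fun h' => eq_owner_of_mem_nearFamily_one hΓ h', fun h' => by rw [h', ← hγo]; exact hγ⟩
    · rw [← hγo]; exact (hΓ.1 γ (nearFamily_subset _ _ _ hγ)).1.ne_empty

/-- The owner hypothesis of `DPR`'s clause (I) makes the radius-`1` near families disjoint. -/
theorem disjoint_nearFamily_one_of_owner {q : ℕ} {Γ : Finset (Finset (Cell q))} (hΓ : Compatible Γ)
    {cA cB : Cell q} (hown : owner Γ cA ≠ owner Γ cB ∨ (owner Γ cA = ∅ ∧ owner Γ cB = ∅)) :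
    Disjoint (nearFamily Γ cA 1) (nearFamily Γ cB 1) := by
  rw [Finset.disjoint_left]
  intro γ hA hB
  have h1 := eq_owner_of_mem_nearFamily_one hΓ hA
  have h2 := eq_owner_of_mem_nearFamily_one hΓ hB
  have hne : γ ≠ ∅ := (hΓ.1 γ (nearFamily_subset _ _ _ hA)).1.ne_empty
  rcases hown with h | ⟨h, -⟩
  · exact h (h1.symm.trans h2)
  · exact hne (h1.trans h)

variable {G : Type} [Group G] [TopologicalSpace G] [IsTopologicalGroup G] [CompactSpace G]
  [MeasurableSpace G] [BorelSpace G] {n : ℕ} {ρ : G →* Matrix (Fin n) (Fin n) ℂ} {β : ℝ}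

/-- **The reshaped format refines the original: `DPRk ⇒ DPR`** (same data; clause (I) at `k = 1` via disjoint near
families; clause (D) at `k = 1` via `Φ(owner) := Φ'(∅)` or `Φ'({owner})`). -/
theorem dpr_of_dprk {S b : ℕ} {p : ℝ} (h : DPRk ρ β S b p) : DPR ρ β S b p := by
  classical
  obtain ⟨q, w, hg, act, Z, ν, hZ, hact, hν0, hsum, hmass, hI, hD⟩ := h
  refine ⟨q, w, hg, act, Z, ν, hZ, hact, hν0, hsum, hmass, ?_, ?_⟩
  · intro Γ hΓ cA cB A B hAm hBm hAb hBb hA hB h4 hown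
    exact hI Γ hΓ 1 cA cB A B hAm hBm hAb hBb hA hB (by omega) (disjoint_nearFamily_one_of_owner hΓ hown)
  · intro cA A hAm hAb hA
    obtain ⟨Φ', hΦ'⟩ := hD 1 cA A hAm hAb hA
    refine ⟨fun o => if o = ∅ then Φ' ∅ else Φ' {o}, fun Γ hΓ => ?_⟩
    rw [hΦ' Γ hΓ]
    dsimp only
    rcases nearFamily_one_cases hΓ cA with ⟨hn, ho⟩ | ⟨hn, ho⟩
    · rw [hn, ho, if_pos rfl]
    · rw [hn, if_neg ho]

/-- `ESRungK ⇒ ESRung`. -/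
theorem esRung_of_esRungK (h : ESRungK) : ESRung := by
  intro G _ _ _ _ _ _ n ρ hρ p hp
  obtain ⟨β₀, hβ₀, hK⟩ := h G n ρ hρ p hp
  exact ⟨β₀, hβ₀, fun β hβ S => dpr_of_dprk (hK β hβ S)⟩

end Summit.QuantumFields.YangMills.Cruxes.IR.EsPolymer

end
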